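import Summits.AtomisticToContinuum.BoseEinsteinCondensation.Theses.BECJelliumDischarge
import Literature.MathematicalPhysics.QuantumManyBody.JelliumBoseGas
import Literature.MathematicalPhysics.QuantumManyBody.BoseGasThermodynamicLimitRuelle
import HarnessLib

/-!
# Birth skeleton — crux `ChargedGasBEC` (stmt-AtomisticToContinuum-13668), route `BECJelliumDischarge`

`Lines/birth.lean` of the crux (BC3 of the Lean birth certificate; registrar unit
`skel-stmt-AtomisticToContinuum-13668`). The crux, BY NAME:
`Summit.AtomisticToContinuum.BoseEinsteinCondensation.Theses.BECJelliumDischarge.ChargedGasBEC`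
— ground-state BEC of the Dirichlet-box jellium-plus-core Bose gas at fixed small `r_s`
(`q = κρ^{1/3}`, `0 < κ < κ₀(v)`) and all small densities: `λ_max(γ) ≥ cN` uniformly over
`δ`-near-minimisers of the charged energy, eventually in `N`, `L = (N/ρ)^{1/3}`. The route item is
typed INLINE (three `let`s); its `cN / cE / jel` are VERBATIM the bodies of
`JelliumBoseGas.chargedCondensateNumber / chargedEnergy / jelliumInteraction`, so the item is
DEFINITIONALLY the vocabulary statement `… ≤ chargedCondensateNumber v (κρ^{1/3}) ρ N (sideLength ρ N)`
(refuter notes on the item: `Iff.rfl`; re-checked here: `ChargedGasBEC_of` below is accepted by `rfl`-unification).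

## The line = the route's own TWO-LAYER PLAN, typed: `LocalChargedCondensation → PhaseLocking → ChargedGasBEC`

Partition `Λ_L` into `M³` congruent open cells `Q_k = BoseGas.subBox ℓ ℓ k`, `k : Fin 3 → Fin M`, of side
`ℓ = L/M` pinned to a FIXED multiple of the interparticle distance, `K ρ^{-1/3} ≤ ℓ ≤ 2K ρ^{-1/3}`
(so `M ≍ N^{1/3}`; in the route's notation `ℓ = K' ℓ_cor`, `ℓ_cor = (8πκ)^{-1/4} ρ^{-1/3}`), with normalised
cell modes `u_k = ℓ^{-3/2}·1_{Q_k}`. The LOCAL CONDENSATE MASS of a state `Ψ` at scale `M` is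
`Σ_k ⟨u_k, γ_Ψ u_k⟩ = Σ_k occupation N u_k Ψ` (`≤ N` always, Bessel).

* `stub_localCondensation` — MESOSCOPIC ODLRO AT EVERY FIXED MULTIPLE OF THE INTERPARTICLE SCALE: for every
  admissible core `v`, deficiency `ε > 0` and scale `K > 0` there are `κ₀(v,ε,K)` and `ρ₀(v,ε,K,κ)` such that,
  for `0 < κ < κ₀`, `0 < ρ < ρ₀` and all large `N`, some admissible `M` and slack `δ > 0` make every
  `δ`-near-minimiser of `chargedEnergy v (κρ^{1/3}) ρ` carry local condensate mass `≥ (1-ε)N`.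
  (why plausibly true: the Neumann–Poincaré inequality on each cell turns kinetic energy into constant-mode
  deficiency, `n_{Q} − ⟨u_Q, γ u_Q⟩ ≤ (ℓ/π)² T_Q`, and `Σ_Q T_Q = T(Ψ)` exactly; the kinetic energy of a
  near-minimiser is a priori `≲ N(aρ + κρ^{2/3}) + δ` — dilute upper bound for the core (Dyson / LSSY Thm 2.2
  trial state, as in support item `ChargedEnergyFinite`) against the LANDED electrostatic floor
  `JelliumBoseGas.chargedEnergy_ge` (Onsager–Lieb–Narnhofer, `−(3/2)qNρ^{1/3}`) — whence deficiency
  `≲ K²((ρa³)^{1/3} + κ)`, small for fixed `K` once `κ < κ₀(ε,K)`, `ρ < ρ₀`; Lieb–Solovej 2001 Lemma 5.1 is the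
  printed per-box version.)  Size: L (genuine: trial-state upper bound for core + Coulomb, cell Poincaré for
  `occupation`, the integer bookkeeping of `M`; it needs `E₀ < ⊤`, i.e. support item 13671, exactly like the crux).
* `stub_phaseLocking` — INTER-CELL PHASE LOCKING OF THE CHARGED JOSEPHSON ARRAY: for every admissible `v` there
  are a deficiency `ε > 0`, a scale `K > 0` and `κ₀ > 0` such that for `0 < κ < κ₀` and all small `ρ` there is
  `c > 0` with: for all large `N`, some slack `δ > 0`, every admissible `M` and every `δ`-near-minimiser `Ψ`,
  local condensate mass `≥ (1-ε)N` at scale `M` ⟹ `λ_max(γ_Ψ) ≥ cN`.  (why plausibly true: at fixed `r_s` the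
  cells form a Josephson array with `E_J/E_c ≍ ρ^{2/3}ℓ²/κ ≍ K²/κ ≫ 1`, whose 3-d quantum-rotor caricature
  orders (reflection positivity / infrared bounds for rotors); destroying inter-cell coherence costs
  `≍ N ρ^{2/3}/K²`, unaffordable at slack `δ = O(1)`; the plasmon gap makes density fluctuations between cells
  massive.)  Size: XL / open — THIS is the crux's heart ("no known inequality turns local incompressibility into
  L-uniform phase locking", route header; grounder census on the item: LS2001 prints local condensation per
  little box, inter-box phase locking is the true gap).
* `ChargedGasBEC_of_sigs` (kernel-checked, no sorry): `stub₁-sig → stub₂-sig → <vocabulary form of the crux>` —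
  phase locking gives `ε, K, κ₁`; local condensation at `(ε, K)` gives `κ₂`; `κ₀ := min κ₁ κ₂`; for `κ < κ₀` the
  two density thresholds are intersected; for `ρ` below both, `c` comes from locking; on the intersection of the
  two eventual sets take the cell number `M` and slack `δ₁` of local condensation and the slack `δ₂` of locking,
  `δ := min δ₁ δ₂ > 0`: every `δ`-near-minimiser is locally condensed (stub 1) hence has `λ_max ≥ cN` (stub 2),
  and `JelliumBoseGas.le_chargedCondensateNumber` closes.  `ChargedGasBEC_of : …Theses.BECJelliumDischarge.ChargedGasBEC
  := ChargedGasBEC_of_sigs stub_localCondensation stub_phaseLocking` is the registered skeleton theorem (crux BY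
  NAME, definitional unfolding of the inline `let`s only; the only such theorem in the file; a by-name conclusion
  under the raw signatures would be `skeleton.extra-hypothesis` for `#h21_check_skeleton`, hence the curried
  `_of_sigs` concludes the vocabulary form).

Hardest stub: `stub_phaseLocking`. Barriers: `KineticGapLengthScales` is used INSIDE its proven lengths only by
stub 1 (cells of FIXED side `≍ Kρ^{-1/3} ≪ ℓ_c`, never growing with `L`); stub 2 uses no gap × L² and is where
the barrier's obstruction ("phase coherence beyond ℓ_c") must be beaten by the Coulomb/plasmon structure — it is
not evaded, it is the bet of the route. `EnergyAsymptoticsWithoutCondensation`: no stub consumes `foldyLaw`.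
Disproof used: none exists (`ledger crux ls stmt-AtomisticToContinuum-13668`: no workfiles before this one;
`ledger negatives --problem AtomisticToContinuum`, 20 entries 2026-08-17: nothing on jellium / cell condensation /
phase locking of near-minimisers — the refuted `BerryStiffPhaseLRO` (14490) is a lattice-RG stiffness statement
with explicit constants, unrelated in form).

BC3 probes (registrar folder `bc/probe_<stub>_to_{crux,summit}.lean` + `bc/probe_extra_crux.lean`, importing the
route file + the two vocabulary modules, never this file): per (stub, target) pair the combined
`first | exact? | simpa | aesop` (with and without a preliminary `intro`), and `exact?`, `simpa`, `aesop` singly,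
under `maxHeartbeats 400000`; plus `exact?` at 4 000 000 heartbeats and an `unfold ChargedGasBEC` variant against
the crux — 5 files, 24 examples, 24 failures (rc 1 each; `exact?`: "could not close the goal" for all four pairs —
at 400k against the summit, at 4M against the crux where the 400k run stops at a `whnf` heartbeat timeout;
`simpa`: "Tactic `assumption` failed"; `aesop`: "failed to prove the goal after exhaustive search"). No stub is
cheaply the crux or the summit (raw outputs: the unit's NOTES.md and `Lines/birth.md`).
-/

noncomputable section

namespace Summit.AtomisticToContinuum.BoseEinsteinCondensation.Cruxes.ChargedGasBEC.Birth

open MeasureTheory ENNReal Filter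
open Literature.MathematicalPhysics.QuantumManyBody.BoseGas
open Literature.MathematicalPhysics.QuantumManyBody.JelliumBoseGas
open Summit.AtomisticToContinuum.BoseEinsteinCondensation.Theses.BECJelliumDischarge

/-! ## Registered stubs -/

/-- **stub 1 — mesoscopic condensation of charged near-minimisers at every fixed multiple of the
interparticle scale.** For every admissible core `v`, deficiency `ε > 0` and scale `K > 0` there is
`κ₀ > 0` such that for `0 < κ < κ₀` there is `ρ₀ > 0` with: for `0 < ρ < ρ₀` and all large `N` there are a
cell number `M ≥ 1` with `Kρ^{-1/3} ≤ L/M ≤ 2Kρ^{-1/3}` (`L = sideLength ρ N`) and a slack `δ > 0` such that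
every `δ`-near-minimiser `Ψ` of `chargedEnergy v (κρ^{1/3}) ρ` has local condensate mass
`Σ_{k : Fin 3 → Fin M} ⟨u_k, γ_Ψ u_k⟩ ≥ (1-ε)N`, `u_k = (L/M)^{-3/2}·1_{subBox (L/M) (L/M) k}`. -/
theorem stub_localCondensation :
    ∀ v : ℝ → ℝ≥0∞, IsRepulsiveFiniteRange v → ∀ ε : ℝ, 0 < ε → ∀ K : ℝ, 0 < K →
      ∃ κ₀ : ℝ, 0 < κ₀ ∧ ∀ κ : ℝ, 0 < κ → κ < κ₀ → ∃ ρ₀ : ℝ, 0 < ρ₀ ∧ ∀ ρ : ℝ, 0 < ρ → ρ < ρ₀ →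
        ∀ᶠ N : ℕ in atTop, ∃ M : ℕ, 0 < M ∧
          K * ρ ^ (-(1 / 3 : ℝ)) ≤ sideLength ρ N / M ∧
          sideLength ρ N / M ≤ 2 * K * ρ ^ (-(1 / 3 : ℝ)) ∧
          ∃ δ : ℝ≥0∞, 0 < δ ∧ ∀ Ψ : TrialState N (sideLength ρ N),
            chargedEnergy v (κ * ρ ^ (1 / 3 : ℝ)) ρ Ψ ≤
                chargedGroundStateEnergy v (κ * ρ ^ (1 / 3 : ℝ)) ρ N (sideLength ρ N) + δ →
              ENNReal.ofReal ((1 - ε) * N) ≤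
                ∑ k : Fin 3 → Fin M, occupation N
                  ((subBox (sideLength ρ N / M) (sideLength ρ N / M) (fun j => (k j : ℕ))).indicator
                    fun _ => ((Real.sqrt ((sideLength ρ N / M) ^ 3))⁻¹ : ℂ)) Ψ.ψ := by
  sorry

/-- **stub 2 — inter-cell phase locking of charged near-minimisers.** For every admissible core `v`
there are a deficiency `ε > 0`, a scale `K > 0` and `κ₀ > 0` such that for `0 < κ < κ₀` there is `ρ₀ > 0`
with: for `0 < ρ < ρ₀` there is `c > 0` such that for all large `N` some slack `δ > 0` makes, for every
cell number `M ≥ 1` with `Kρ^{-1/3} ≤ L/M ≤ 2Kρ^{-1/3}` and every `δ`-near-minimiser `Ψ` of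
`chargedEnergy v (κρ^{1/3}) ρ`: local condensate mass `≥ (1-ε)N` at scale `M` ⟹ `λ_max(γ_Ψ) ≥ cN`. -/
theorem stub_phaseLocking :
    ∀ v : ℝ → ℝ≥0∞, IsRepulsiveFiniteRange v → ∃ ε : ℝ, 0 < ε ∧ ∃ K : ℝ, 0 < K ∧
      ∃ κ₀ : ℝ, 0 < κ₀ ∧ ∀ κ : ℝ, 0 < κ → κ < κ₀ → ∃ ρ₀ : ℝ, 0 < ρ₀ ∧ ∀ ρ : ℝ, 0 < ρ → ρ < ρ₀ →
        ∃ c : ℝ, 0 < c ∧ ∀ᶠ N : ℕ in atTop, ∃ δ : ℝ≥0∞, 0 < δ ∧ ∀ M : ℕ, 0 < M →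
          K * ρ ^ (-(1 / 3 : ℝ)) ≤ sideLength ρ N / M →
          sideLength ρ N / M ≤ 2 * K * ρ ^ (-(1 / 3 : ℝ)) →
          ∀ Ψ : TrialState N (sideLength ρ N),
            chargedEnergy v (κ * ρ ^ (1 / 3 : ℝ)) ρ Ψ ≤
                chargedGroundStateEnergy v (κ * ρ ^ (1 / 3 : ℝ)) ρ N (sideLength ρ N) + δ →
            ENNReal.ofReal ((1 - ε) * N) ≤
                ∑ k : Fin 3 → Fin M, occupation N
                  ((subBox (sideLength ρ N / M) (sideLength ρ N / M) (fun j => (k j : ℕ))).indicator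
                    fun _ => ((Real.sqrt ((sideLength ρ N / M) ^ 3))⁻¹ : ℂ)) Ψ.ψ →
              ENNReal.ofReal (c * N) ≤ maxOccupation N Ψ.ψ := by
  sorry

/-! ## Proved composition (no sorry below this line) -/

/-- **Composition with the stub STATEMENTS as hypotheses (kernel-checked, no sorry):**
`stub₁-signature → stub₂-signature → <vocabulary form of the crux>` (the crux unfolds to it by `rfl`).
Pure logic (mins of thresholds, intersection of eventual sets, `δ := min δ₁ δ₂`) plus
`JelliumBoseGas.le_chargedCondensateNumber`. It concludes the vocabulary form rather than the crux
constant so that exactly one theorem of this file — `ChargedGasBEC_of` — concludes the crux BY NAME. -/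
theorem ChargedGasBEC_of_sigs :
    (∀ v : ℝ → ℝ≥0∞, IsRepulsiveFiniteRange v → ∀ ε : ℝ, 0 < ε → ∀ K : ℝ, 0 < K →
      ∃ κ₀ : ℝ, 0 < κ₀ ∧ ∀ κ : ℝ, 0 < κ → κ < κ₀ → ∃ ρ₀ : ℝ, 0 < ρ₀ ∧ ∀ ρ : ℝ, 0 < ρ → ρ < ρ₀ →
        ∀ᶠ N : ℕ in atTop, ∃ M : ℕ, 0 < M ∧
          K * ρ ^ (-(1 / 3 : ℝ)) ≤ sideLength ρ N / M ∧
          sideLength ρ N / M ≤ 2 * K * ρ ^ (-(1 / 3 : ℝ)) ∧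
          ∃ δ : ℝ≥0∞, 0 < δ ∧ ∀ Ψ : TrialState N (sideLength ρ N),
            chargedEnergy v (κ * ρ ^ (1 / 3 : ℝ)) ρ Ψ ≤
                chargedGroundStateEnergy v (κ * ρ ^ (1 / 3 : ℝ)) ρ N (sideLength ρ N) + δ →
              ENNReal.ofReal ((1 - ε) * N) ≤
                ∑ k : Fin 3 → Fin M, occupation N
                  ((subBox (sideLength ρ N / M) (sideLength ρ N / M) (fun j => (k j : ℕ))).indicator
                    fun _ => ((Real.sqrt ((sideLength ρ N / M) ^ 3))⁻¹ : ℂ)) Ψ.ψ) →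
    (∀ v : ℝ → ℝ≥0∞, IsRepulsiveFiniteRange v → ∃ ε : ℝ, 0 < ε ∧ ∃ K : ℝ, 0 < K ∧
      ∃ κ₀ : ℝ, 0 < κ₀ ∧ ∀ κ : ℝ, 0 < κ → κ < κ₀ → ∃ ρ₀ : ℝ, 0 < ρ₀ ∧ ∀ ρ : ℝ, 0 < ρ → ρ < ρ₀ →
        ∃ c : ℝ, 0 < c ∧ ∀ᶠ N : ℕ in atTop, ∃ δ : ℝ≥0∞, 0 < δ ∧ ∀ M : ℕ, 0 < M →
          K * ρ ^ (-(1 / 3 : ℝ)) ≤ sideLength ρ N / M →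
          sideLength ρ N / M ≤ 2 * K * ρ ^ (-(1 / 3 : ℝ)) →
          ∀ Ψ : TrialState N (sideLength ρ N),
            chargedEnergy v (κ * ρ ^ (1 / 3 : ℝ)) ρ Ψ ≤
                chargedGroundStateEnergy v (κ * ρ ^ (1 / 3 : ℝ)) ρ N (sideLength ρ N) + δ →
            ENNReal.ofReal ((1 - ε) * N) ≤
                ∑ k : Fin 3 → Fin M, occupation N
                  ((subBox (sideLength ρ N / M) (sideLength ρ N / M) (fun j => (k j : ℕ))).indicator
                    fun _ => ((Real.sqrt ((sideLength ρ N / M) ^ 3))⁻¹ : ℂ)) Ψ.ψ →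
              ENNReal.ofReal (c * N) ≤ maxOccupation N Ψ.ψ) →
    ∀ v : ℝ → ℝ≥0∞, IsRepulsiveFiniteRange v →
      ∃ κ₀ : ℝ, 0 < κ₀ ∧ ∀ κ : ℝ, 0 < κ → κ < κ₀ → ∃ ρ₀ : ℝ, 0 < ρ₀ ∧ ∀ ρ : ℝ, 0 < ρ → ρ < ρ₀ →
        ∃ c : ℝ, 0 < c ∧ ∀ᶠ N : ℕ in atTop,
          ENNReal.ofReal (c * N) ≤
            chargedCondensateNumber v (κ * ρ ^ (1 / 3 : ℝ)) ρ N (sideLength ρ N) := by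
  intro hloc hlock v hv
  obtain ⟨ε, hε, K, hK, κ₁, hκ₁, hlock⟩ := hlock v hv
  obtain ⟨κ₂, hκ₂, hloc⟩ := hloc v hv ε hε K hK
  refine ⟨min κ₁ κ₂, lt_min hκ₁ hκ₂, fun κ hκ hκlt => ?_⟩
  obtain ⟨ρ₁, hρ₁, hlock⟩ := hlock κ hκ (lt_of_lt_of_le hκlt (min_le_left _ _))
  obtain ⟨ρ₂, hρ₂, hloc⟩ := hloc κ hκ (lt_of_lt_of_le hκlt (min_le_right _ _))
  refine ⟨min ρ₁ ρ₂, lt_min hρ₁ hρ₂, fun ρ hρ hρlt => ?_⟩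
  obtain ⟨c, hc, hlock⟩ := hlock ρ hρ (lt_of_lt_of_le hρlt (min_le_left _ _))
  have hloc := hloc ρ hρ (lt_of_lt_of_le hρlt (min_le_right _ _))
  refine ⟨c, hc, ?_⟩
  filter_upwards [hlock, hloc] with N hN₁ hN₂
  obtain ⟨δ₂, hδ₂, hlockN⟩ := hN₁
  obtain ⟨M, hM, hlo, hhi, δ₁, hδ₁, hlocN⟩ := hN₂
  refine le_chargedCondensateNumber v _ ρ (lt_min hδ₁ hδ₂) fun Ψ hΨ => ?_
  exact hlockN M hM hlo hhi Ψ (hΨ.trans (add_le_add le_rfl (min_le_right _ _)))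
    (hlocN Ψ (hΨ.trans (add_le_add le_rfl (min_le_left _ _))))

/-- **THE SKELETON THEOREM — the crux BY NAME from the two registered stubs** (the only theorem of
this file whose conclusion is the crux constant; no hypotheses; its only `sorry`s are the two
`stub_*` above, reached through `ChargedGasBEC_of_sigs`; the inline `let`s of the route item unfold to
the vocabulary form definitionally). When both stubs land as Theorems this term, with the stubs replaced
by their proofs, is the closing proof of item stmt-AtomisticToContinuum-13668. -/
theorem ChargedGasBEC_of :
    Summit.AtomisticToContinuum.BoseEinsteinCondensation.Theses.BECJelliumDischarge.ChargedGasBEC :=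
  ChargedGasBEC_of_sigs stub_localCondensation stub_phaseLocking

end Summit.AtomisticToContinuum.BoseEinsteinCondensation.Cruxes.ChargedGasBEC.Birth

end
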